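import Mathlib.Analysis.Calculus.MeanValue
import Literature.Analysis.FunctionSpaces.ContDiffHolderSpace
import HarnessLib

/-!
# Interpolation inequalities for `C¹`, `C²` and `C^{2,r}` norms (Hölder spaces, part 19)

Topic `Literature/Analysis/FunctionSpaces`. The elementary global interpolation inequalities
behind Gilbarg–Trudinger 2001, Lemma 6.35 / (6.82)–(6.86) ("`|u|_{j,β} ≤ C(ε)|u|₀ + ε|u|_{k,α}` for
`j + β < k + α`"), in the global (whole-space) form used for compactly supported or bounded
functions:

* `norm_fderiv_le_of_modulus` — the one-step principle: if `f` is differentiable and bounded by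
  `A`, and `‖Df(y) − Df(x)‖ ≤ ω` on the ball `B̄(x, h)`, then `‖Df(x)‖ ≤ 2A/h + ω` (mean value
  theorem applied to `y ↦ f y − Df(x)(y − x)` on the ball);
* `norm_fderiv_le_of_norm_fderiv_fderiv_le` — `‖Du‖_∞ ≤ 2‖u‖_∞/h + h‖D²u‖_∞`;
* `norm_fderiv_fderiv_le_of_holderWith` — `‖D²u‖_∞ ≤ 2‖Du‖_∞/h + [D²u]_r h^r`;
* for members of `C^{2,r}_b(E, F)` (part 3): `norm_iteratedFDeriv_one_le_interpolate`,
  `norm_iteratedFDeriv_two_le_interpolate`.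

These are the absorption tools of the Schauder estimates (freezing of coefficients and patching,
items (2a)-B/C of the census of `Literature.Geometry.Riemannian.gurskyViaclovsky_pathOpen_weighted_four`).
Everything is proved; no named facts.

## References

* D. Gilbarg, N. S. Trudinger, *Elliptic Partial Differential Equations of Second Order* (2001),
  Lemma 6.35, (6.82)–(6.86). [GilbargTrudinger2001]
-/

noncomputable section

open Set Filter Metric
open scoped NNReal

namespace Literature.Analysis.FunctionSpaces

section General

variable {E G : Type*} [NormedAddCommGroup E] [NormedSpace ℝ E] [NormedAddCommGroup G]
  [NormedSpace ℝ G]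

/-- **The one-step interpolation principle.** Let `f : E → G` be differentiable with `‖f‖ ≤ A`,
`0 < h`, and suppose `‖Df(y) − Df(x)‖ ≤ ω` for all `y` in the closed ball `B̄(x, h)`. Then
`‖Df(x)‖ ≤ 2A/h + ω`. Proof: the mean value theorem for `g(y) = f(y) − Df(x)(y − x)` on the ball
gives `‖f(x + hv) − f(x) − h Df(x)v‖ ≤ ω h` for `‖v‖ = 1`. [cite: GilbargTrudinger2001, Lemma 6.35] -/
theorem norm_fderiv_le_of_modulus {f : E → G} (hf : Differentiable ℝ f) {A ω h : ℝ} (hh : 0 < h)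
    (hA : ∀ y, ‖f y‖ ≤ A) (x : E) (hω : ∀ y ∈ closedBall x h, ‖fderiv ℝ f y - fderiv ℝ f x‖ ≤ ω) :
    ‖fderiv ℝ f x‖ ≤ 2 * A / h + ω := by
  have hA0 : 0 ≤ A := (norm_nonneg _).trans (hA x)
  have hω0 : 0 ≤ ω := (norm_nonneg _).trans (hω x (mem_closedBall_self hh.le))
  refine ContinuousLinearMap.opNorm_le_of_unit_norm (by positivity) fun v hv => ?_
  -- the auxiliary function and its derivative
  set g : E → G := fun y => f y - fderiv ℝ f x y with hg
  have hgd : ∀ y, HasFDerivAt g (fderiv ℝ f y - fderiv ℝ f x) y := fun y =>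
    (hf y).hasFDerivAt.sub (fderiv ℝ f x).hasFDerivAt
  have hgdiff : ∀ y ∈ closedBall x h, DifferentiableAt ℝ g y := fun y _ => (hgd y).differentiableAt
  have hgbound : ∀ y ∈ closedBall x h, ‖fderiv ℝ g y‖ ≤ ω := fun y hy => by
    rw [(hgd y).fderiv]
    exact hω y hy
  have hxh : x + h • v ∈ closedBall x h := by
    rw [mem_closedBall, dist_eq_norm, add_sub_cancel_left, norm_smul, Real.norm_eq_abs,
      abs_of_pos hh, hv, mul_one]
  have hMVT := (convex_closedBall x h).norm_image_sub_le_of_norm_fderiv_le hgdiff hgbound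
    (mem_closedBall_self hh.le) hxh
  -- `g(x + hv) − g(x) = (f(x + hv) − f(x)) − h • Df(x) v`
  have hgval : g (x + h • v) - g x = (f (x + h • v) - f x) - h • fderiv ℝ f x v := by
    simp only [hg, map_add, map_smul]
    abel
  rw [hgval, add_sub_cancel_left, norm_smul, Real.norm_eq_abs, abs_of_pos hh, hv, mul_one] at hMVT
  -- `h ‖Df(x) v‖ ≤ 2A + ω h`
  have hfsub : ‖f (x + h • v) - f x‖ ≤ 2 * A :=
    (norm_sub_le _ _).trans (by linarith [hA (x + h • v), hA x])
  have h1 : ‖h • fderiv ℝ f x v‖ ≤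
      ‖f (x + h • v) - f x‖ + ‖(f (x + h • v) - f x) - h • fderiv ℝ f x v‖ := by
    calc ‖h • fderiv ℝ f x v‖
        = ‖(f (x + h • v) - f x) - ((f (x + h • v) - f x) - h • fderiv ℝ f x v)‖ := by
          rw [sub_sub_cancel]
      _ ≤ ‖f (x + h • v) - f x‖ + ‖(f (x + h • v) - f x) - h • fderiv ℝ f x v‖ := norm_sub_le _ _
  rw [norm_smul, Real.norm_eq_abs, abs_of_pos hh] at h1
  have hkey : ‖fderiv ℝ f x v‖ * h ≤ (2 * A / h + ω) * h := by
    rw [add_mul, div_mul_cancel₀ _ hh.ne']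
    nlinarith
  exact le_of_mul_le_mul_right hkey hh

/-- **`‖Du‖_∞ ≤ 2‖u‖_∞/h + h‖D²u‖_∞`** for twice differentiable `u` with `‖u‖ ≤ A`,
`‖D²u‖ ≤ C₂` (`ω = C₂ h` by the mean value theorem for `Du`). [cite: GilbargTrudinger2001, (6.82)] -/
theorem norm_fderiv_le_of_norm_fderiv_fderiv_le {u : E → G} (hu : Differentiable ℝ u)
    (hDu : Differentiable ℝ (fderiv ℝ u)) {A C₂ h : ℝ} (hh : 0 < h) (hA : ∀ y, ‖u y‖ ≤ A)
    (hC₂ : ∀ y, ‖fderiv ℝ (fderiv ℝ u) y‖ ≤ C₂) (x : E) :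
    ‖fderiv ℝ u x‖ ≤ 2 * A / h + C₂ * h := by
  refine norm_fderiv_le_of_modulus hu hh hA x fun y hy => ?_
  have hMVT := (convex_closedBall x h).norm_image_sub_le_of_norm_fderiv_le
    (fun z _ => hDu z) (fun z _ => hC₂ z) (mem_closedBall_self hh.le) hy
  have hyx : ‖y - x‖ ≤ h := by rwa [mem_closedBall, dist_eq_norm] at hy
  have hC0 : 0 ≤ C₂ := (norm_nonneg (fderiv ℝ (fderiv ℝ u) x)).trans (hC₂ x)
  exact hMVT.trans (mul_le_mul_of_nonneg_left hyx hC0)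

/-- **`‖D²u‖_∞ ≤ 2‖Du‖_∞/h + [D²u]_r h^r`** for twice differentiable `u` with `‖Du‖ ≤ A₁` and
`D(Du)` `r`-Hölder with constant `C` (`ω = C h^r`). [cite: GilbargTrudinger2001, (6.86)] -/
theorem norm_fderiv_fderiv_le_of_holderWith {u : E → G} (hDu : Differentiable ℝ (fderiv ℝ u))
    {A₁ h : ℝ} {C r : ℝ≥0} (hh : 0 < h) (hA₁ : ∀ y, ‖fderiv ℝ u y‖ ≤ A₁)
    (hC : HolderWith C r (fderiv ℝ (fderiv ℝ u))) (x : E) :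
    ‖fderiv ℝ (fderiv ℝ u) x‖ ≤ 2 * A₁ / h + C * h ^ (r : ℝ) := by
  refine norm_fderiv_le_of_modulus hDu hh hA₁ x fun y hy => ?_
  have h1 := hC.dist_le y x
  rw [dist_eq_norm, dist_eq_norm] at h1
  have hyx : ‖y - x‖ ≤ h := by rwa [mem_closedBall, dist_eq_norm] at hy
  exact h1.trans (mul_le_mul_of_nonneg_left
    (Real.rpow_le_rpow (norm_nonneg _) hyx (NNReal.coe_nonneg r)) (NNReal.coe_nonneg C))

end General

/-! ### Members of `C^{k,r}_b` -/

section Members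

variable {E F : Type*} [NormedAddCommGroup E] [NormedSpace ℝ E] [NormedAddCommGroup F]
  [NormedSpace ℝ F] {k : ℕ} {r : ℝ≥0}

namespace ContDiffHolderFunction

/-- **Intermediate derivatives**: for `u ∈ C^{k,r}_b` and `n + 2 ≤ k`,
`‖Dⁿ⁺¹u(x)‖ ≤ 2A/h + ‖u‖ h` for every `h > 0`, where `A` bounds `‖Dⁿu‖` (the modulus of `Dⁿ⁺¹u`
on `B̄(x,h)` is `≤ ‖Dⁿ⁺²u‖_∞ h ≤ ‖u‖ h`). With `h = ε`: `‖Dⁿ⁺¹u‖_∞ ≤ ε‖u‖_{k,r} + (2/ε)‖Dⁿu‖_∞`.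
[cite: GilbargTrudinger2001, (6.82)] -/
theorem norm_iteratedFDeriv_succ_le_interpolate (u : ContDiffHolderFunction E F k r) {n : ℕ}
    (hn : n + 2 ≤ k) {h : ℝ} (hh : 0 < h) {A : ℝ} (hA : ∀ y, ‖iteratedFDeriv ℝ n (u : E → F) y‖ ≤ A)
    (x : E) : ‖iteratedFDeriv ℝ (n + 1) (u : E → F) x‖ ≤ 2 * A / h + ‖u‖ * h := by
  have hn1 : n + 1 ≤ k := (Nat.le_succ _).trans hn
  -- `f = Dⁿu`
  have hf : Differentiable ℝ (iteratedFDeriv ℝ n (u : E → F)) :=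
    u.contDiff.differentiable_iteratedFDeriv (by exact_mod_cast hn1)
  have hf1 : Differentiable ℝ (iteratedFDeriv ℝ (n + 1) (u : E → F)) :=
    u.contDiff.differentiable_iteratedFDeriv (by exact_mod_cast hn)
  -- mean value theorem for `Dⁿ⁺¹u` on the ball
  have hmod : ∀ y ∈ closedBall x h,
      ‖iteratedFDeriv ℝ (n + 1) (u : E → F) y - iteratedFDeriv ℝ (n + 1) (u : E → F) x‖ ≤ ‖u‖ * h := by
    intro y hy
    have hMVT := (convex_closedBall x h).norm_image_sub_le_of_norm_fderiv_le
      (fun z _ => hf1 z) (fun z _ => by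
        rw [norm_fderiv_iteratedFDeriv]
        exact u.norm_iteratedFDeriv_le_norm hn z) (mem_closedBall_self hh.le) hy
    have hyx : ‖y - x‖ ≤ h := by rwa [mem_closedBall, dist_eq_norm] at hy
    exact hMVT.trans (mul_le_mul_of_nonneg_left hyx (norm_nonneg _))
  have hmain := norm_fderiv_le_of_modulus hf hh hA x (ω := ‖u‖ * h) fun y hy => by
    rw [← dist_eq_norm, fderiv_iteratedFDeriv, Function.comp_apply, Function.comp_apply,
      LinearIsometryEquiv.dist_map, dist_eq_norm]
    exact hmod y hy
  rwa [norm_fderiv_iteratedFDeriv] at hmain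

/-- **Top derivative**: for `u ∈ C^{m+1,r}_b`, `‖Dᵐ⁺¹u(x)‖ ≤ 2A/h + ‖u‖ h^r` for every `h > 0`,
where `A` bounds `‖Dᵐu‖` (the modulus of `Dᵐ⁺¹u` is `[Dᵐ⁺¹u]_r h^r ≤ ‖u‖ h^r`). With `h = ε`:
`‖Dᵐ⁺¹u‖_∞ ≤ ε^r ‖u‖_{m+1,r} + (2/ε)‖Dᵐu‖_∞`. [cite: GilbargTrudinger2001, (6.86)] -/
theorem norm_iteratedFDeriv_top_le_interpolate {m : ℕ} (u : ContDiffHolderFunction E F (m + 1) r)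
    {h : ℝ} (hh : 0 < h) {A : ℝ} (hA : ∀ y, ‖iteratedFDeriv ℝ m (u : E → F) y‖ ≤ A) (x : E) :
    ‖iteratedFDeriv ℝ (m + 1) (u : E → F) x‖ ≤ 2 * A / h + ‖u‖ * h ^ (r : ℝ) := by
  have hf : Differentiable ℝ (iteratedFDeriv ℝ m (u : E → F)) :=
    u.contDiff.differentiable_iteratedFDeriv (by exact_mod_cast Nat.lt_succ_self m)
  have hH := u.memHolder.holderWith
  have hmain := norm_fderiv_le_of_modulus hf hh hA x (ω := ‖u‖ * h ^ (r : ℝ)) fun y hy => by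
    rw [← dist_eq_norm, fderiv_iteratedFDeriv, Function.comp_apply, Function.comp_apply,
      LinearIsometryEquiv.dist_map]
    have h1 := hH.dist_le y x
    have hyx : ‖y - x‖ ≤ h := by rwa [mem_closedBall, dist_eq_norm] at hy
    refine h1.trans ?_
    rw [dist_eq_norm]
    exact mul_le_mul u.nnHolderNorm_le_norm
      (Real.rpow_le_rpow (norm_nonneg _) hyx (NNReal.coe_nonneg r)) (by positivity) (norm_nonneg _)
  rwa [norm_fderiv_iteratedFDeriv] at hmain

/-- **`ε`-form for the first derivative of a member of `C^{k+2,r}_b`**: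
`‖Du(x)‖ ≤ ε‖u‖ + (2/ε) sup|u|` for every `ε > 0`. [cite: GilbargTrudinger2001, (6.82)] -/
theorem norm_iteratedFDeriv_one_le_interpolate (u : ContDiffHolderFunction E F (k + 2) r) {ε : ℝ}
    (hε : 0 < ε) {A : ℝ} (hA : ∀ y, ‖u y‖ ≤ A) (x : E) :
    ‖iteratedFDeriv ℝ 1 (u : E → F) x‖ ≤ 2 * A / ε + ‖u‖ * ε :=
  norm_iteratedFDeriv_succ_le_interpolate u (n := 0) (Nat.le_add_left 2 k) hε
    (fun y => by rw [norm_iteratedFDeriv_zero]; exact hA y) x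

end ContDiffHolderFunction

end Members

end Literature.Analysis.FunctionSpaces

end
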